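import Literature.MathematicalPhysics.QuantumFieldTheory.Balaban1983to89.B6BlockDecayHprimeCovV1
import Literature.MathematicalPhysics.QuantumFieldTheory.Balaban1983to89.B6Repr2129Operator
import Literature.MathematicalPhysics.QuantumFieldTheory.BalabanImbrieJaffe1984to88.BIJ85Prop12AllTori

/-!
# `Balaban1983to89.B6BlockDecayGtV1` — T. Bałaban, *Propagators and renormalization transformations for lattice gauge theories. II*,
# Commun. Math. Phys. **96** (1984) 223–250 [Balaban1984PropagatorsII], (2.130)–(2.131) and Prop. 2.5 p. 246: the operator `G̃_j` of the
# representation (2.129) has an exponentially decaying BLOCK kernel for the concrete two-scale data `tsV1` at the paper's scaling, uniformly in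
# the volume, `j`, `Λ′` and the weights — by [4] Proposition 1.2 for `G_j` — file 6 of the two-level decay programme

statement-level skeleton of published theorems with citation tags; proofs where landed; nothing here is a claim about the Yang–Mills mass gap

p. 246: *"Thus this operator coincides with the operator introduced in Sect. D. For G̃_j we get G̃_j = G_j − G_jQ_j*(Q_jG_jQ_j*)⁻¹Q_jG_j. (2.131)
From these representations we obtain all the necessary properties of the operators H_j, G̃_j. They follow from the Proposition 1.2 and from
the formulas and the inequalities (1.99)–(1.101) for Q_jG_jQ_j*."*

WHAT THIS FILE DOES.  §1 THE WEIGHTED IDENTIFICATION: for every `w′ > 0`, `M_j + w′Q_j*Q_j` of `tsV1` IS `Δ_a = ∂*∂ + ∂R∂* + Q*aQ` (2.19) of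
the whole-torus family of order `j` with the constant weight `w′` (`MjQ_smul_eq_deltaAE`, gen 9's `…B6Eq2130TwoScaleV1Landau.MjQ_eq_deltaAE`
at weight `1`, verbatim otherwise), hence `(M_j + w′Q_j*Q_j)⁻¹ = G` of (2.22) (`inverse_MjQ_smul_apply`) and, by file 1's weight freedom
(`…B6Repr2129Operator.Gt_eq_comp_smul_V1`), **`G̃_j = (I − H_jQ_j)G^{(w′)}`** for every `w′ > 0` (`Gt_eq_comp_GE`).  §2 AT THE SCALING
`c = L^j`, `w′ = a·n^{d+1}` ([4]'s weight `a`, r03's dictionary `…B6GOneLevelV1Bridge.GE_apply_eq_sum_Gk`: `G^{(w′)}` IS p09's kernel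
`Gk = Re Δ_a⁻¹` of [4] (1.71)) [4] PROPOSITION 1.2 (1.110)₀ — p19's `…BIJ85Prop12AllTori.prop12Printed_allTori_allScales`, hypothesis-free,
ONE `δ₀`, ONE `O(1)` for all tori — gives `G^{(w′)}` the block bound `(O(1), δ₀)` (`blockBound_GE_scaling`; file 2's `blockBound_of_cubeSup`
with [4]'s cubes `Δ̃(y) ⊃ B^j(y)`, p09's `mem_cube_blk`, file 4's bridge `supDist = |rep· − rep·|_T`).  §3 `Q_j` has the block bound
`(e^{δ}, δ)` for every `δ ≥ 0` (`blockBound_Qv`: p09's averaging kernel of (1.18), `torusRep_std_Q_row` = 1 and its range `QsStd_range`).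
§4 **`G̃_j` HAS AN EXPONENTIALLY DECAYING BLOCK KERNEL, UNIFORMLY** (`blockBound_Gt_scaling`): `Σ_{b₀′ : y(b₀′₋) = y}|G̃_j(e_{b₀′})_{b₀}| ≤
C·e^{−δ|y(b₀₋) − y|_T}` with `δ > 0`, `C ≥ 0` depending on `d, L` only — file 3's `blockBound_Hj`, §3, §2 composed by file 2.

DICTIONARY / DIVERGENCES. (1) Carriers, position maps, metric as in files 3–5. (2) [4]'s cube `Δ̃(y)` (p09's `torusRep`: `|x − y|_∞ < L^k`,
centred convention) contains the block `B^j(y)`, which is all that is used (`r = 0` blocks). (3) The auxiliary weight `w′ = a·n^{d+1}` is the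
free weight of file 1 §4, NOT the weights `w` of `tsV1` (only `w > 0` is needed); `a = 1` in §4. (4) No new definition, no new hypothesis;
everything by NAME from [4] Prop. 1.2 as landed (p19), r03's bridge, p09's torus carrier, gen 9, files 1–4.  NOT summit progress.
Unit `lit-balaban-p22` (gen 14), 2026-08-22.
-/

noncomputable section

open scoped InnerProductSpace BigOperators Matrix
open Finset

namespace Literature.MathematicalPhysics.QuantumFieldTheory.Balaban1983to89.B6BlockDecayGtV1

open LatticeFieldCalculus B5SectBStatements B5Eq117TorusCarriers B6SectADomainsV1 B6SectAOperatorsV1 B6SectAVectorModelV1 B6SectCOperators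
  B6SectCTwoScaleV1 B6SectCTwoScaleV1Lattice B5Eq118OneStroke
open BalabanImbrieJaffe1984to88.BIJ85AxialPropagator411 (BondSpace)
open B4Sect5Torus (IsPseudoDist SumBound)
open B4TorusKernel (periodConst)
open B4TorusKernel.MultiPeriod (torusSupNorm torusSupNorm_nonneg)
open B4Sect5Proof (latticeConst latticeConst_nonneg)
open B5Hk163Decay (MG163 MG163_nonneg)
open B5Hk163Strip (kappa163 kappa163_pos)
open B5Kernel166Decay (periodConst_pos)
open B6LowerBound2153Torus (rep)
open B6CovarianceOperator (inverse_apply)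
open B6SectCOperators.TwoScaleData (form_Mj)
open B6SectAWholeTorusData (idxB idxB_bijective)
open B6Eq2130TwoScaleV1Landau (norm_Qv_sq_eq_sum Rj_eq_RE)
open B6HjGtOpNormV1 (qpE_whole_eq_zero_iff inner_QE_aE_whole)
open B6GOneLevelV1Bridge (GE_apply_eq_sum_Gk)
open B6Repr2129Operator (inner_MjQa MjQa_symm MjQa_pos Gt_eq_comp_smul_V1)
open B6BlockDecayCalculus (blockBound_comp blockBound_sub blockBound_mono blockBound_of_cubeSup torusDist_isPseudoDist torusDist_sumBound)
open B6BlockDecayHjCovV1 (blockBound_Hj)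
open B6BlockDecayHprimeCovV1 (supDist_cast_eq_torusSupNorm eq_of_torusDist_le_zero)
open BalabanImbrieJaffe1984to88.BIJ85Ineq722Torus (torusRep torusRep_dY mem_cube_blk stdData torusRep_std_Q_mulVec torusRep_std_Q_apply
  torusRep_std_Q_row QsStd QsStd_nonneg QsStd_range)
open BalabanImbrieJaffe1984to88.BIJ85Ineq722DeltaA (Gk deltaAData)
open BalabanImbrieJaffe1984to88.BIJ85Ineq722ProofPart2 (prop12Hyps_of_ineq110_114)
open BalabanImbrieJaffe1984to88.BIJ85Prop12AllTori (prop12Printed_allTori_allScales)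

/-! ## §1  The weighted identification: `M_j + w′Q_j*Q_j = Δ_a` (2.19) with weight `w′`, `G̃_j = (I − H_jQ_j)G^{(w′)}` -/

section Weighted

variable {P : Params} {c : ℝ} (hc : c ≠ 0) {j : ℕ} (hj : j + 1 ≤ P.m + P.K) (Λ' : Finset (Site P (j + 1)))
  {w : CIdx j Λ' → ℝ} (hw : ∀ i, 0 < w i)

include hj hw

/-- **`M_j + w′Q_j*Q_j` of `tsV1` IS `Δ_a = ∂*∂ + ∂R∂* + Q*aQ` (2.19) of the whole-torus family of order `j` with the constant weight `w′`**
([4] (1.69) *"Δ_a = Δ − ∂P∂* + aQ*Q … R = I − P"*; gen 9's `MjQ_eq_deltaAE` is the case `w′ = 1`). [cite: Balaban1984PropagatorsII, (2.19) p.226 + (2.130) p.246] -/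
theorem MjQ_smul_eq_deltaAE (w' : ℝ) :
    (tsV1 hc Λ' w).Mj + LinearMap.adjoint (tsV1 hc Λ' w).Qv ∘ₗ (w' • LinearMap.id) ∘ₗ (tsV1 hc Λ' w).Qv =
      deltaAE (Domains.whole (P := P) j (Nat.le_of_succ_le hj)) c (fun _ => w') := by
  have hL := isLattice Λ' hc hj hw
  set Wj := Domains.whole (P := P) j (Nat.le_of_succ_le hj) with hWj
  set S := ((tsV1 hc Λ' w).Mj + LinearMap.adjoint (tsV1 hc Λ' w).Qv ∘ₗ (w' • LinearMap.id) ∘ₗ (tsV1 hc Λ' w).Qv) -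
    deltaAE Wj c (fun _ => w') with hS
  have has : ∀ x y : UBond P j, ⟪(w' • LinearMap.id : UBond P j →ₗ[ℝ] UBond P j) x, y⟫_ℝ = ⟪x, (w' • LinearMap.id : UBond P j →ₗ[ℝ] UBond P j) y⟫_ℝ :=
    fun x y => by rw [LinearMap.smul_apply, LinearMap.id_apply, LinearMap.smul_apply, LinearMap.id_apply, real_inner_smul_left, real_inner_smul_right]
  have hsym : S.IsSymmetric := fun x y => by
    rw [hS, LinearMap.sub_apply, LinearMap.sub_apply, inner_sub_left, inner_sub_right, MjQa_symm (w' • LinearMap.id) hL has,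
      inner_deltaAE_left]
  have h1 : ∀ v : BondSpace P, ⟪v, ((tsV1 hc Λ' w).Mj + LinearMap.adjoint (tsV1 hc Λ' w).Qv ∘ₗ (w' • LinearMap.id) ∘ₗ (tsV1 hc Λ' w).Qv) v⟫_ℝ =
      ‖dcE c v‖ ^ 2 + ‖RE Wj c (dsE c v)‖ ^ 2 + ∑ i, w' * QE Wj v i ^ 2 := by
    intro v
    rw [inner_MjQa, form_Mj hL, LinearMap.smul_apply, LinearMap.id_apply, real_inner_smul_right, real_inner_self_eq_norm_sq,
      norm_Qv_sq_eq_sum hc hj Λ', Rj_eq_RE hc Λ' (Nat.le_of_succ_le hj), Finset.mul_sum]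
    simp only [one_mul]
    rfl
  have h0 : ∀ v, ⟪S v, v⟫_ℝ = 0 := fun v => by
    rw [hS, LinearMap.sub_apply, inner_sub_left, MjQa_symm (w' • LinearMap.id) hL has, inner_deltaAE_left, h1, inner_deltaAE_self]
    exact sub_self _
  exact sub_eq_zero.mp (hsym.inner_map_self_eq_zero.mp h0)

/-- **`(M_j + w′Q_j*Q_j)⁻¹ = G` (2.22) of the whole-torus family with weight `w′`**, `w′ > 0` (gen 9's `Gj_eq_GE` at `w′ = 1`).
[cite: Balaban1984PropagatorsII, (2.22) p.226 + (2.130) p.246] -/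
theorem inverse_MjQ_smul_apply {w' : ℝ} (hw' : 0 < w') (v : BondSpace P) :
    Ring.inverse ((tsV1 hc Λ' w).Mj + LinearMap.adjoint (tsV1 hc Λ' w).Qv ∘ₗ (w' • LinearMap.id) ∘ₗ (tsV1 hc Λ' w).Qv) v =
      GE (Domains.whole (P := P) j (Nat.le_of_succ_le hj)) hc (w := fun _ => w') (fun _ => hw') v := by
  have hL := isLattice Λ' hc hj hw
  have hP := positive Λ' hc hj w
  have hap : ∀ x : UBond P j, x ≠ 0 → 0 < ⟪x, (w' • LinearMap.id : UBond P j →ₗ[ℝ] UBond P j) x⟫_ℝ := fun x hx => by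
    rw [LinearMap.smul_apply, LinearMap.id_apply, real_inner_smul_right, real_inner_self_eq_norm_sq]
    exact mul_pos hw' (by positivity)
  have h2 : ((tsV1 hc Λ' w).Mj + LinearMap.adjoint (tsV1 hc Λ' w).Qv ∘ₗ (w' • LinearMap.id) ∘ₗ (tsV1 hc Λ' w).Qv)
      (GE (Domains.whole (P := P) j (Nat.le_of_succ_le hj)) hc (w := fun _ => w') (fun _ => hw') v) = v := by
    rw [MjQ_smul_eq_deltaAE hc hj Λ' hw w']
    exact deltaAE_GE _ hc _ v
  calc Ring.inverse ((tsV1 hc Λ' w).Mj + LinearMap.adjoint (tsV1 hc Λ' w).Qv ∘ₗ (w' • LinearMap.id) ∘ₗ (tsV1 hc Λ' w).Qv) v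
      = Ring.inverse ((tsV1 hc Λ' w).Mj + LinearMap.adjoint (tsV1 hc Λ' w).Qv ∘ₗ (w' • LinearMap.id) ∘ₗ (tsV1 hc Λ' w).Qv)
          (((tsV1 hc Λ' w).Mj + LinearMap.adjoint (tsV1 hc Λ' w).Qv ∘ₗ (w' • LinearMap.id) ∘ₗ (tsV1 hc Λ' w).Qv)
            (GE (Domains.whole (P := P) j (Nat.le_of_succ_le hj)) hc (w := fun _ => w') (fun _ => hw') v)) := by rw [h2]
    _ = GE (Domains.whole (P := P) j (Nat.le_of_succ_le hj)) hc (w := fun _ => w') (fun _ => hw') v :=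
        inverse_apply _ (MjQa_pos (w' • LinearMap.id) hL hP hap) _

/-- **`G̃_j = (I − H_jQ_j)G^{(w′)}` for every `w′ > 0`**, `G^{(w′)} = G` (2.22) of the whole-torus family with weight `w′` ((2.131) with (2.130),
through file 1's weight freedom). [cite: Balaban1984PropagatorsII, (2.130)–(2.131) p.246] -/
theorem Gt_eq_comp_GE {w' : ℝ} (hw' : 0 < w') :
    (tsV1 hc Λ' w).Gt = (LinearMap.id - (tsV1 hc Λ' w).Hj ∘ₗ (tsV1 hc Λ' w).Qv) ∘ₗ
      GE (Domains.whole (P := P) j (Nat.le_of_succ_le hj)) hc (w := fun _ => w') (fun _ => hw') := by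
  rw [Gt_eq_comp_smul_V1 hc hj Λ' hw hw']
  congr 1
  exact LinearMap.ext fun v => inverse_MjQ_smul_apply hc hj Λ' hw hw' v

end Weighted

/-! ## §2  [4] Proposition 1.2 (1.110)₀ for `G^{(w′)}` at the scaling: a block bound with constants depending on `d, L, a` only -/

section Prop12

variable {d L m K : ℕ} {hd : 1 ≤ d + 1} {hL : Odd L ∧ 1 < L} {j : ℕ}

open Classical in
/-- **[4] PROPOSITION 1.2, (1.110)₀, FOR `G^{(w′)}` AS A BLOCK BOUND** (`c = L^j`, `w′ = a·n^{d+1}`): there are `δ > 0`, `C ≥ 0` depending on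
`d, L, a` only such that for every volume `(m, K)`, every `j ≤ m + K`, all fine bonds `b₀` and unit sites `y`,
`Σ_{b₀′ : y(b₀′₋) = y}|G^{(w′)}(e_{b₀′})_{b₀}| ≤ C·e^{−δ|y(b₀₋) − y|_T}` — p19's hypothesis-free `prop12Printed_allTori_allScales` (ONE `δ₀`, ONE `O(1)`
for all tori of dimension `d + 1` and block size `L`), its member `e110_0` (`|(GJ)(x)| ≤ O(1)e^{−δ₀|y − y′|}|J|` for `x ∈ Δ̃(y)`, `supp J ⊂ Δ̃(y′)`),
r03's `GE_apply_eq_sum_Gk` (`G^{(w′)}` = p09's kernel `Gk`), the blocks inside the cubes (`mem_cube_blk`) and file 2's `blockBound_of_cubeSup`.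
[cite: Balaban1984PropagatorsI, Prop. 1.2 (1.110) p.35; Balaban1984PropagatorsII, p.246 («They follow from the Proposition 1.2»)] -/
theorem blockBound_GE_scaling (d L : ℕ) (hd : 1 ≤ d + 1) (hL : Odd L ∧ 1 < L) {a : ℝ} (ha : 0 < a) :
    ∃ δ : ℝ, 0 < δ ∧ ∃ C : ℝ, 0 ≤ C ∧ ∀ (m K j : ℕ)
      (hj' : j ≤ (⟨d + 1, L, m, K, hd, hL⟩ : Params).m + (⟨d + 1, L, m, K, hd, hL⟩ : Params).K) (hc : ((L : ℝ) ^ j) ≠ 0)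
      (hw' : (0 : ℝ) < a * ((L : ℝ) ^ j) ^ (d + 1))
      (b₀ : PBond (⟨d + 1, L, m, K, hd, hL⟩ : Params) 0) (y : Site (⟨d + 1, L, m, K, hd, hL⟩ : Params) j),
      ∑ b₀' ∈ univ.filter (fun b₀' : PBond (⟨d + 1, L, m, K, hd, hL⟩ : Params) 0 => iterBlockOf j b₀'.src = y),
          |GE (Domains.whole (P := (⟨d + 1, L, m, K, hd, hL⟩ : Params)) j hj') hc
            (w := fun _ => a * ((L : ℝ) ^ j) ^ (d + 1)) (fun _ => hw') (EuclideanSpace.single b₀' (1 : ℝ)) b₀| ≤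
        C * Real.exp (-(δ * torusSupNorm (Mk (⟨d + 1, L, m, K, hd, hL⟩ : Params) j)
            (rep (Mk (⟨d + 1, L, m, K, hd, hL⟩ : Params) j) (iterBlockOf j b₀.src) - rep (Mk (⟨d + 1, L, m, K, hd, hL⟩ : Params) j) y))) := by
  obtain ⟨δ₀, C, Cα, Cε, Cαε, hδ₀, hC, H⟩ := prop12Printed_allTori_allScales (a := a) (d + 1) L ha
  refine ⟨δ₀, hδ₀, C, hC.le, fun m K j hj' hc hw' b₀ y => ?_⟩
  have h12 := prop12Hyps_of_ineq110_114 (R := torusRep (⟨d + 1, L, m, K, hd, hL⟩ : Params) j (deltaAData hj' a)) hC.le hδ₀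
    (H ⟨((⟨d + 1, L, m, K, hd, hL⟩ : Params), j), rfl, rfl, hj'⟩)
  have hρ : IsPseudoDist (fun t t' : Site (⟨d + 1, L, m, K, hd, hL⟩ : Params) j => torusSupNorm (Mk (⟨d + 1, L, m, K, hd, hL⟩ : Params) j)
      (rep (Mk (⟨d + 1, L, m, K, hd, hL⟩ : Params) j) t - rep (Mk (⟨d + 1, L, m, K, hd, hL⟩ : Params) j) t')) :=
    torusDist_isPseudoDist (Mk (⟨d + 1, L, m, K, hd, hL⟩ : Params) j)
  refine blockBound_of_cubeSup (ρ := (fun t t' : Site (⟨d + 1, L, m, K, hd, hL⟩ : Params) j => torusSupNorm (Mk (⟨d + 1, L, m, K, hd, hL⟩ : Params) j) (rep (Mk (⟨d + 1, L, m, K, hd, hL⟩ : Params) j) t - rep (Mk (⟨d + 1, L, m, K, hd, hL⟩ : Params) j) t')))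
    hρ _ (fun b₀ : PBond (⟨d + 1, L, m, K, hd, hL⟩ : Params) 0 => iterBlockOf j b₀.src)
    (fun b₀ : PBond (⟨d + 1, L, m, K, hd, hL⟩ : Params) 0 => iterBlockOf j b₀.src) le_rfl (fun x X y y' hX hsupp hx i hi => ?_) b₀ y
  -- the vector field on p09's index set
  set J : Site (⟨d + 1, L, m, K, hd, hL⟩ : Params) 0 × Fin (d + 1) → ℝ := fun jj => x ⟨jj.1, jj.2⟩ with hJ
  have hiy : iterBlockOf j i.src = y := eq_of_torusDist_le_zero hi
  have hGE : GE (Domains.whole (P := (⟨d + 1, L, m, K, hd, hL⟩ : Params)) j hj') hc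
      (w := fun _ => a * ((L : ℝ) ^ j) ^ (d + 1)) (fun _ => hw') x i = (Gk hj' a *ᵥ J) (i.src, i.dir) := by
    rw [GE_apply_eq_sum_Gk hj' (Domains.whole (P := (⟨d + 1, L, m, K, hd, hL⟩ : Params)) j hj') (qpE_whole_eq_zero_iff hj')
      (fun _ => hw') ha (inner_QE_aE_whole hj' a) x i, Matrix.mulVec, dotProduct]
    exact (Fintype.sum_equiv (LatticeFieldCalculus.bondEquiv) _ _ fun jj => rfl).symm
  have hsuppJ : ∀ jj : Site (⟨d + 1, L, m, K, hd, hL⟩ : Params) 0 × Fin (d + 1), J jj ≠ 0 →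
      jj.1 ∈ (torusRep (⟨d + 1, L, m, K, hd, hL⟩ : Params) j (deltaAData hj' a)).cube y' := by
    intro jj hjj
    have e : iterBlockOf j jj.1 = y' := eq_of_torusDist_le_zero (hsupp ⟨jj.1, jj.2⟩ hjj)
    rw [← e]
    exact mem_cube_blk hj' jj.1
  have hiin : i.src ∈ (torusRep (⟨d + 1, L, m, K, hd, hL⟩ : Params) j (deltaAData hj' a)).cube y := by
    rw [← hiy]
    exact mem_cube_blk hj' i.src
  have h := h12.e110_0 J y y' hsuppJ (i.src, i.dir) hiin
  have hJn : ‖J‖ ≤ X := (pi_norm_le_iff_of_nonneg hX).2 fun jj => by rw [Real.norm_eq_abs]; exact hx ⟨jj.1, jj.2⟩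
  rw [hGE]
  refine h.trans ?_
  rw [torusRep_dY, supDist_cast_eq_torusSupNorm]
  exact mul_le_mul_of_nonneg_left hJn (by positivity)

end Prop12

/-! ## §3  `Q_j` has the block bound `(e^{δ}, δ)` for every `δ ≥ 0` -/

section Qv

variable {d L m K : ℕ} {hd : 1 ≤ d + 1} {hL : Odd L ∧ 1 < L} {c : ℝ} (hc : c ≠ 0) {j : ℕ}
  (hj' : j ≤ (⟨d + 1, L, m, K, hd, hL⟩ : Params).m + (⟨d + 1, L, m, K, hd, hL⟩ : Params).K)
  (Λ' : Finset (Site (⟨d + 1, L, m, K, hd, hL⟩ : Params) (j + 1))) (w : CIdx j Λ' → ℝ)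
  [DecidableEq (PBond (⟨d + 1, L, m, K, hd, hL⟩ : Params) 0)]

include hj' in
/-- **the entries of `Q_j`** are p09's averaging kernel of (1.18): `Q_j(e_{b₀})_b = η^{d+1}·#{straight contours of b through b₀}`
(`torusRep_std_Q_mulVec`, `QsStd`). [cite: Balaban1984PropagatorsI, (1.18) p.20] -/
theorem Qv_single_apply (b₀ : PBond (⟨d + 1, L, m, K, hd, hL⟩ : Params) 0) (b : PBond (⟨d + 1, L, m, K, hd, hL⟩ : Params) j) :
    (tsV1 hc Λ' w).Qv (EuclideanSpace.single b₀ (1 : ℝ)) b =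
      (⟨d + 1, L, m, K, hd, hL⟩ : Params).eta j ^ (d + 1) * QsStd (⟨d + 1, L, m, K, hd, hL⟩ : Params) j (b₀.src, b₀.dir) (b.src, b.dir) := by
  have h := torusRep_std_Q_mulVec (G := 0) (DG := 0) hj' (WithLp.ofLp (EuclideanSpace.single b₀ (1 : ℝ))) (b.src, b.dir)
  have e : (tsV1 hc Λ' w).Qv (EuclideanSpace.single b₀ (1 : ℝ)) b = bondAvgIter j (WithLp.ofLp (EuclideanSpace.single b₀ (1 : ℝ))) ⟨b.src, b.dir⟩ := rfl
  rw [e, ← h]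
  show ∑ jj : Site (⟨d + 1, L, m, K, hd, hL⟩ : Params) 0 × Fin (d + 1),
      (⟨d + 1, L, m, K, hd, hL⟩ : Params).eta j ^ (d + 1) * QsStd (⟨d + 1, L, m, K, hd, hL⟩ : Params) j jj (b.src, b.dir) *
        WithLp.ofLp (EuclideanSpace.single b₀ (1 : ℝ)) ⟨jj.1, jj.2⟩ = _
  rw [Finset.sum_eq_single (b₀.src, b₀.dir)]
  · rw [show WithLp.ofLp (EuclideanSpace.single b₀ (1 : ℝ)) ⟨(b₀.src, b₀.dir).1, (b₀.src, b₀.dir).2⟩ =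
        EuclideanSpace.single b₀ (1 : ℝ) b₀ from rfl, PiLp.single_apply, if_pos rfl, mul_one]
  · intro jj _ hjj
    rw [show WithLp.ofLp (EuclideanSpace.single b₀ (1 : ℝ)) ⟨jj.1, jj.2⟩ = EuclideanSpace.single b₀ (1 : ℝ) ⟨jj.1, jj.2⟩ from rfl,
      PiLp.single_apply, if_neg, mul_zero]
    intro h'
    apply hjj
    rw [← h']
  · intro h'
    exact absurd (Finset.mem_univ _) h'

include hj' in
/-- **`Q_j` HAS THE BLOCK BOUND `(e^{δ}, δ)` FOR EVERY `δ ≥ 0`** (unit bonds ← fine bonds): `Σ_{b₀ : y(b₀₋) = y′}|Q_j(e_{b₀})_b| ≤ e^{δ}e^{−δ|b₋ − y′|_T}` — the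
row mass is `Σ_{b₀}|Q(b, b₀)| = 1` (`torusRep_std_Q_row`) and an entry vanishes unless `|y(b₀₋) − b₋| ≤ 1` (`QsStd_range`).
[cite: Balaban1984PropagatorsI, (1.18) p.20] -/
theorem blockBound_Qv {δ : ℝ} (hδ : 0 ≤ δ) (b : PBond (⟨d + 1, L, m, K, hd, hL⟩ : Params) j) (y' : Site (⟨d + 1, L, m, K, hd, hL⟩ : Params) j) :
    ∑ b₀ ∈ univ.filter (fun b₀ : PBond (⟨d + 1, L, m, K, hd, hL⟩ : Params) 0 => iterBlockOf j b₀.src = y'),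
        |(tsV1 hc Λ' w).Qv (EuclideanSpace.single b₀ (1 : ℝ)) b| ≤
      Real.exp δ * Real.exp (-(δ * torusSupNorm (Mk (⟨d + 1, L, m, K, hd, hL⟩ : Params) j)
        (rep (Mk (⟨d + 1, L, m, K, hd, hL⟩ : Params) j) b.src - rep (Mk (⟨d + 1, L, m, K, hd, hL⟩ : Params) j) y'))) := by
  have hρ : IsPseudoDist (fun t t' : Site (⟨d + 1, L, m, K, hd, hL⟩ : Params) j => torusSupNorm (Mk (⟨d + 1, L, m, K, hd, hL⟩ : Params) j)
      (rep (Mk (⟨d + 1, L, m, K, hd, hL⟩ : Params) j) t - rep (Mk (⟨d + 1, L, m, K, hd, hL⟩ : Params) j) t')) :=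
    torusDist_isPseudoDist (Mk (⟨d + 1, L, m, K, hd, hL⟩ : Params) j)
  by_cases hfar : torusSupNorm (Mk (⟨d + 1, L, m, K, hd, hL⟩ : Params) j)
      (rep (Mk (⟨d + 1, L, m, K, hd, hL⟩ : Params) j) b.src - rep (Mk (⟨d + 1, L, m, K, hd, hL⟩ : Params) j) y') ≤ 1
  · -- the whole row mass is 1
    have h1 : ∑ b₀ ∈ univ.filter (fun b₀ : PBond (⟨d + 1, L, m, K, hd, hL⟩ : Params) 0 => iterBlockOf j b₀.src = y'),
          |(tsV1 hc Λ' w).Qv (EuclideanSpace.single b₀ (1 : ℝ)) b| ≤ 1 := by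
      calc ∑ b₀ ∈ univ.filter (fun b₀ : PBond (⟨d + 1, L, m, K, hd, hL⟩ : Params) 0 => iterBlockOf j b₀.src = y'),
            |(tsV1 hc Λ' w).Qv (EuclideanSpace.single b₀ (1 : ℝ)) b|
          ≤ ∑ b₀ : PBond (⟨d + 1, L, m, K, hd, hL⟩ : Params) 0, |(tsV1 hc Λ' w).Qv (EuclideanSpace.single b₀ (1 : ℝ)) b| :=
            Finset.sum_le_sum_of_subset_of_nonneg (Finset.filter_subset _ _) fun _ _ _ => abs_nonneg _
        _ = ∑ jj : Site (⟨d + 1, L, m, K, hd, hL⟩ : Params) 0 × Fin (d + 1),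
              |(⟨d + 1, L, m, K, hd, hL⟩ : Params).eta j ^ (d + 1) * QsStd (⟨d + 1, L, m, K, hd, hL⟩ : Params) j jj (b.src, b.dir)| :=
            Fintype.sum_equiv (LatticeFieldCalculus.bondEquiv (P := (⟨d + 1, L, m, K, hd, hL⟩ : Params)) (j := 0)).symm
              (fun b₀ : PBond (⟨d + 1, L, m, K, hd, hL⟩ : Params) 0 => |(tsV1 hc Λ' w).Qv (EuclideanSpace.single b₀ (1 : ℝ)) b|)
              (fun jj => |(⟨d + 1, L, m, K, hd, hL⟩ : Params).eta j ^ (d + 1) * QsStd (⟨d + 1, L, m, K, hd, hL⟩ : Params) j jj (b.src, b.dir)|)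
              fun b₀ => by rw [Qv_single_apply hc hj' Λ' w]; rfl
        _ = 1 := torusRep_std_Q_row (G := 0) (DG := 0) hj' (b.src, b.dir)
    refine h1.trans ?_
    rw [← Real.exp_add]
    exact Real.one_le_exp (by nlinarith [mul_nonneg hδ (sub_nonneg.2 hfar)])
  · -- no fine bond of the block `y′` is averaged into `b`
    have h0 : ∑ b₀ ∈ univ.filter (fun b₀ : PBond (⟨d + 1, L, m, K, hd, hL⟩ : Params) 0 => iterBlockOf j b₀.src = y'),
          |(tsV1 hc Λ' w).Qv (EuclideanSpace.single b₀ (1 : ℝ)) b| = 0 := by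
      refine Finset.sum_eq_zero fun b₀ hb₀ => ?_
      rw [Qv_single_apply hc hj' Λ' w, abs_eq_zero]
      by_contra hne
      have hQ : QsStd (⟨d + 1, L, m, K, hd, hL⟩ : Params) j (b₀.src, b₀.dir) (b.src, b.dir) ≠ 0 := fun h => hne (by rw [h, mul_zero])
      have hr := QsStd_range hj' (b₀.src, b₀.dir) (b.src, b.dir) hQ
      rw [show (b₀.src, b₀.dir).1 = b₀.src from rfl, show (b.src, b.dir).1 = b.src from rfl, (Finset.mem_filter.mp hb₀).2,
        supDist_cast_eq_torusSupNorm, hρ.symm] at hr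
      exact hfar hr
    rw [h0]
    positivity

end Qv

/-! ## §4  `G̃_j` at the paper's scaling: a block bound uniform in the volume, `j`, `Λ′`, the weights -/

section Scaling

variable {d L m K : ℕ} {hd : 1 ≤ d + 1} {hL : Odd L ∧ 1 < L} {j : ℕ}

open Classical in
/-- **`G̃_j` HAS AN EXPONENTIALLY DECAYING BLOCK KERNEL, UNIFORMLY** (at `c = L^j`): there are `δ > 0`, `C ≥ 0` depending on `d, L` only such that
for every volume `(m, K)`, every `j + 1 ≤ m + K`, every `Λ′ ⊂ T^{(j+1)}`, all positive weights and all fine bonds `b₀`, unit sites `y`: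
`Σ_{b₀′ : y(b₀′₋) = y}|G̃_j(e_{b₀′})_{b₀}| ≤ C·e^{−δ|y(b₀₋) − y|_T}` — `G̃_j = G^{(n^{d+1})} − H_jQ_jG^{(n^{d+1})}` (§1 at `w′ = n^{d+1}`, [4]'s `a = 1`),
`G^{(n^{d+1})}` `(O(1), δ₀)` by [4] Prop. 1.2 (§2), `Q_j` `(e^{κ_H}, κ_H)` (§3), `H_j` `(A_H(d+1), κ_H)` (file 3), composed and subtracted by file 2.
[cite: Balaban1984PropagatorsII, (2.131) p.246, Prop. 2.5 p.246] -/
theorem blockBound_Gt_scaling (d L : ℕ) (hd : 1 ≤ d + 1) (hL : Odd L ∧ 1 < L) :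
    ∃ δ : ℝ, 0 < δ ∧ ∃ C : ℝ, 0 ≤ C ∧ ∀ (m K : ℕ) (j : ℕ) (hc : ((L : ℝ) ^ j) ≠ 0)
      (_hj : j + 1 ≤ (⟨d + 1, L, m, K, hd, hL⟩ : Params).m + (⟨d + 1, L, m, K, hd, hL⟩ : Params).K)
      (Λ' : Finset (Site (⟨d + 1, L, m, K, hd, hL⟩ : Params) (j + 1))) (w : CIdx j Λ' → ℝ) (_hw : ∀ i, 0 < w i)
      (b₀ : PBond (⟨d + 1, L, m, K, hd, hL⟩ : Params) 0) (y : Site (⟨d + 1, L, m, K, hd, hL⟩ : Params) j),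
      ∑ b₀' ∈ univ.filter (fun b₀' : PBond (⟨d + 1, L, m, K, hd, hL⟩ : Params) 0 => iterBlockOf j b₀'.src = y),
          |(tsV1 hc Λ' w).Gt (EuclideanSpace.single b₀' (1 : ℝ)) b₀| ≤
        C * Real.exp (-(δ * torusSupNorm (Mk (⟨d + 1, L, m, K, hd, hL⟩ : Params) j)
            (rep (Mk (⟨d + 1, L, m, K, hd, hL⟩ : Params) j) (iterBlockOf j b₀.src) - rep (Mk (⟨d + 1, L, m, K, hd, hL⟩ : Params) j) y))) := by
  obtain ⟨δG, hδG, CG, hCG, hG⟩ := blockBound_GE_scaling d L hd hL one_pos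
  -- rates: `H_j ∘ Q_j` at `κ_H/2`, `(H_jQ_j) ∘ G` and `G̃_j` at `δ₂ = min(δ_G, κ_H/4)`
  set κH : ℝ := kappa163 (d + 1) / ((d : ℝ) + 1) with hκH
  have hκH0 : 0 < κH := div_pos (kappa163_pos _) (by positivity)
  set δ₂ : ℝ := min δG (κH / 4) with hδ₂
  have hδ₂0 : 0 < δ₂ := lt_min hδG (by positivity)
  have hδ₂G : δ₂ ≤ δG := min_le_left _ _
  have hδ₂H : δ₂ < κH / 2 := lt_of_le_of_lt (min_le_right _ _) (by linarith)
  set A : ℝ := MG163 (d + 1) * periodConst (kappa163 (d + 1)) d with hA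
  have hA0 : 0 ≤ A := mul_nonneg (MG163_nonneg _) (periodConst_pos (kappa163_pos _) _).le
  set K₁ : ℝ := latticeConst (d + 1) (κH - κH / 2) with hK₁
  set K₂ : ℝ := latticeConst (d + 1) (κH / 2 - δ₂) with hK₂
  have hK₁0 : 0 ≤ K₁ := latticeConst_nonneg _ (by linarith)
  have hK₂0 : 0 ≤ K₂ := latticeConst_nonneg _ (by linarith)
  have hL0 : 0 < L := by have := hL.2; omega
  haveI : NeZero L := ⟨by omega⟩
  have hLp : (0 : ℝ) < L := by exact_mod_cast hL0
  set C : ℝ := CG + A * ((1 * (d + 1) : ℕ) : ℝ) * Real.exp κH * K₁ * CG * K₂ with hC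
  have hC0 : 0 ≤ C := by positivity
  refine ⟨δ₂, hδ₂0, C, hC0, ?_⟩
  intro m K j hc hj Λ' w hw b₀ y
  have hj' : j ≤ m + K := Nat.le_of_succ_le hj
  have hLj : (0 : ℝ) < (L : ℝ) ^ j := by positivity
  have hw' : (0 : ℝ) < 1 * ((L : ℝ) ^ j) ^ (d + 1) := by positivity
  have hρ : IsPseudoDist (fun t t' : Site (⟨d + 1, L, m, K, hd, hL⟩ : Params) j => torusSupNorm (Mk (⟨d + 1, L, m, K, hd, hL⟩ : Params) j)
      (rep (Mk (⟨d + 1, L, m, K, hd, hL⟩ : Params) j) t - rep (Mk (⟨d + 1, L, m, K, hd, hL⟩ : Params) j) t')) :=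
    torusDist_isPseudoDist (Mk (⟨d + 1, L, m, K, hd, hL⟩ : Params) j)
  have hK : SumBound (fun t t' : Site (⟨d + 1, L, m, K, hd, hL⟩ : Params) j => torusSupNorm (Mk (⟨d + 1, L, m, K, hd, hL⟩ : Params) j)
      (rep (Mk (⟨d + 1, L, m, K, hd, hL⟩ : Params) j) t - rep (Mk (⟨d + 1, L, m, K, hd, hL⟩ : Params) j) t')) (fun a => latticeConst (d + 1) a) :=
    torusDist_sumBound (Mk (⟨d + 1, L, m, K, hd, hL⟩ : Params) j)
  -- the three factor bounds
  have hGb := hG m K j hj' hc hw'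
  have hH := blockBound_Hj hc hj Λ' hw
  have hQ := blockBound_Qv hc hj' Λ' w hκH0.le
  -- `H_j ∘ Q_j` at rate `κ_H/2`
  have h1 := blockBound_comp hρ hK (tsV1 hc Λ' w).Hj (tsV1 hc Λ' w).Qv
    (fun b₀ : PBond (⟨d + 1, L, m, K, hd, hL⟩ : Params) 0 => iterBlockOf j b₀.src) (fun b : PBond (⟨d + 1, L, m, K, hd, hL⟩ : Params) j => b.src)
    (fun b₀ : PBond (⟨d + 1, L, m, K, hd, hL⟩ : Params) 0 => iterBlockOf j b₀.src)
    (Cf := A * ((1 * (d + 1) : ℕ) : ℝ)) (Cg := Real.exp κH) (by positivity) (by positivity)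
    (show (0 : ℝ) ≤ κH / 2 by positivity) (show κH / 2 ≤ κH by linarith) (show κH / 2 < κH by linarith) hH hQ
  -- `(H_jQ_j) ∘ G` at rate `δ₂`
  have h2 := blockBound_comp hρ hK ((tsV1 hc Λ' w).Hj ∘ₗ (tsV1 hc Λ' w).Qv)
    (GE (Domains.whole (P := (⟨d + 1, L, m, K, hd, hL⟩ : Params)) j hj') hc (w := fun _ => 1 * ((L : ℝ) ^ j) ^ (d + 1)) (fun _ => hw'))
    (fun b₀ : PBond (⟨d + 1, L, m, K, hd, hL⟩ : Params) 0 => iterBlockOf j b₀.src) (fun b₀ : PBond (⟨d + 1, L, m, K, hd, hL⟩ : Params) 0 => iterBlockOf j b₀.src)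
    (fun b₀ : PBond (⟨d + 1, L, m, K, hd, hL⟩ : Params) 0 => iterBlockOf j b₀.src)
    (Cf := A * ((1 * (d + 1) : ℕ) : ℝ) * Real.exp κH * K₁) (Cg := CG) (by positivity) hCG
    hδ₂0.le hδ₂G hδ₂H h1 hGb
  -- `G` itself at rate `δ₂`
  have h3 := blockBound_mono hρ
    (GE (Domains.whole (P := (⟨d + 1, L, m, K, hd, hL⟩ : Params)) j hj') hc (w := fun _ => 1 * ((L : ℝ) ^ j) ^ (d + 1)) (fun _ => hw'))
    (fun b₀ : PBond (⟨d + 1, L, m, K, hd, hL⟩ : Params) 0 => iterBlockOf j b₀.src) (fun b₀ : PBond (⟨d + 1, L, m, K, hd, hL⟩ : Params) 0 => iterBlockOf j b₀.src)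
    hCG le_rfl hδ₂G hGb
  -- `G̃_j = G − (H_jQ_j)G`
  have hGt : (tsV1 hc Λ' w).Gt =
      GE (Domains.whole (P := (⟨d + 1, L, m, K, hd, hL⟩ : Params)) j hj') hc (w := fun _ => 1 * ((L : ℝ) ^ j) ^ (d + 1)) (fun _ => hw') -
        ((tsV1 hc Λ' w).Hj ∘ₗ (tsV1 hc Λ' w).Qv) ∘ₗ
          GE (Domains.whole (P := (⟨d + 1, L, m, K, hd, hL⟩ : Params)) j hj') hc (w := fun _ => 1 * ((L : ℝ) ^ j) ^ (d + 1)) (fun _ => hw') := by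
    rw [Gt_eq_comp_GE hc hj Λ' hw hw', LinearMap.sub_comp, LinearMap.id_comp]
  rw [hGt]
  have h4 := blockBound_sub (ρ := (fun t t' : Site (⟨d + 1, L, m, K, hd, hL⟩ : Params) j => torusSupNorm (Mk (⟨d + 1, L, m, K, hd, hL⟩ : Params) j)
      (rep (Mk (⟨d + 1, L, m, K, hd, hL⟩ : Params) j) t - rep (Mk (⟨d + 1, L, m, K, hd, hL⟩ : Params) j) t'))) _ _
    (fun b₀ : PBond (⟨d + 1, L, m, K, hd, hL⟩ : Params) 0 => iterBlockOf j b₀.src)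
    (fun b₀ : PBond (⟨d + 1, L, m, K, hd, hL⟩ : Params) 0 => iterBlockOf j b₀.src) h3 h2 b₀ y
  refine h4.trans (le_of_eq ?_)
  rw [hC, hK₂]

end Scaling

end Literature.MathematicalPhysics.QuantumFieldTheory.Balaban1983to89.B6BlockDecayGtV1

end
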